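import Summits.FinalStateConjecture.FinalStateConjecture.Theorems.EIHFluxBalanceInertialRecessionRechartFlowOrbit
import Summits.FinalStateConjecture.FinalStateConjecture.Theorems.EIHFluxBalanceInertialRecessionStubRechart3Carter
import Summits.FinalStateConjecture.FinalStateConjecture.Theorems.EIHFluxBalanceInertialRecessionRechartWhiteHoleKerrAlgebra

/-!
# Route EIHFluxBalance — `InertialRecession`, re-charting: the BOOSTED CARTER FLOW of a moving
# rotating hole and its certified reach (model geometry for the transfer of rotating holes)

Helper file for the crux `stmt-FinalStateConjecture-10166`
(`Summit.FinalStateConjecture.FinalStateConjecture.Theses.EIHFluxBalance.InertialRecession`),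
stub `stub_rechart` (the transfer P2 of line `sublinear-is-free-clean-window-charges`).

For the reference background `boostedKerrBackground Λ c M a` of a hole with ANY motion `(Λ, c)`
and ANY spin, the boosted Carter flow `F y σ = c + Λ(carterFlow a (Λ⁻¹(y − c)) σ)` with field
`u y = Λ χ(Λ⁻¹(y − c))` (`χ` the Carter field of `…StubRechart3Carter`) is a flow in the sense of
`…RechartFlowOrbit`: smooth in `σ`, `F y 0 = y`, tangent to `u`, preserving the domain (the boosted
exterior) and the model radius, raising the model time `t*` at unit rate
(`boostedCarterFlow_package`). Its model value is the rest Carter value,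
`Kb(y)(u y, u y) = g_{M,a}(Λ⁻¹(y − c))(χ, χ)`, which is `≤ −m(δ) < 0` uniformly on `{r ≥ r₊ + δ}` for
subextremal parameters (`exists_carter_margin`: `r²Δ/(r² + a²)²` is nondecreasing beyond `|a|`), and
`‖u y‖² ≤ 2‖Λ‖²`. Consequently (`carter_reach_of_certified`) the hypothesis `hstat` of the transfer
`exterior_subset_certified_union_causalPast₂` holds for any chart `ψ` on this background once
`dψ(u)` is certified on the zone — for a re-charted chart `ψ = Φ ∘ A` by
`isFutureDirected_mfderiv_flow_of_deviation` from `C⁰` closeness, (Ofut) and `(DA·u)⁰ > 0`.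
[Carter 1968; O'Neill 1983, Ch. 14; folklore]
-/

noncomputable section

set_option linter.dupNamespace false

open Set Filter Topology Function TopologicalSpace Literature.Geometry.Lorentzian
open Summit.FinalStateConjecture.FinalStateConjecture.Theorems.SublinearIsFree.Rechart
open Summit.FinalStateConjecture.FinalStateConjecture.Theorems.InertialRecession.Negative
open scoped Manifold ContDiff

namespace Summit.FinalStateConjecture.FinalStateConjecture.Theorems

/-! ### The rest Carter flow: smoothness and a uniform timelike margin -/

/-- The Carter flow is smooth in the flow parameter. [folklore] -/
theorem contDiff_carterFlow (a : ℝ) (x : E4) : ContDiff ℝ ∞ (carterFlow a x) := by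
  have h : carterFlow a x = fun s ↦ rotCLM (a / (Kerr.radius a x ^ 2 + a ^ 2) * s) x +
      s • E4.basisVector 0 := funext fun s ↦ rfl
  rw [h]
  exact ((contDiff_rotCLM.comp (contDiff_const.mul contDiff_id)).clm_apply contDiff_const).add
    (contDiff_id.smul contDiff_const)

/-- `Δ(r) ≥ δ²` for `r ≥ r₊ + δ`, `δ ≥ 0`, subextremal parameters (`r − M ≥ √(M² − a²) + δ`).
[folklore] -/
theorem kerrDelta_ge_sq {M a δ r : ℝ} (h : Kerr.IsSubextremal M a) (hδ : 0 ≤ δ)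
    (hr : Kerr.rPlus M a + δ ≤ r) : δ ^ 2 ≤ r ^ 2 - 2 * M * r + a ^ 2 := by
  have ha : a ^ 2 < M ^ 2 := sq_lt_sq' (abs_lt.1 h).1 (abs_lt.1 h).2
  set s : ℝ := Real.sqrt (M ^ 2 - a ^ 2) with hs
  have hs0 : 0 ≤ s := Real.sqrt_nonneg _
  have hs2 : s ^ 2 = M ^ 2 - a ^ 2 := Real.sq_sqrt (by linarith)
  have hrM : s + δ ≤ r - M := by unfold Kerr.rPlus at hr; rw [hs]; linarith
  have h1 : (s + δ) ^ 2 ≤ (r - M) ^ 2 := pow_le_pow_left₀ (by positivity) hrM 2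
  nlinarith

/-- **Uniform timelike margin of the Carter field**: for subextremal `(M, a)` and `δ > 0` there is
`m > 0` with `g_{M,a}(x)(χ, χ) ≤ −m` at every point with `r(x) ≥ r₊ + δ` (the bound
`−r²Δ/(r² + a²)²` of `kerr_bilin_carterField_le` is nonincreasing in `r` beyond `|a|`). [cite: Carter1968] -/
theorem exists_carter_margin {M a δ : ℝ} (h : Kerr.IsSubextremal M a) (hδ : 0 < δ) :
    ∃ m > 0, ∀ x : E4, Kerr.rPlus M a + δ ≤ Kerr.radius a x →
      Kerr.bilin M a x (carterField a x) (carterField a x) ≤ -m := by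
  have hM : 0 < M := h.pos
  set r₀ : ℝ := Kerr.rPlus M a + δ with hr₀
  have hMr : M ≤ Kerr.rPlus M a := by
    unfold Kerr.rPlus; linarith [Real.sqrt_nonneg (M ^ 2 - a ^ 2)]
  have hr₀0 : 0 < r₀ := by rw [hr₀]; linarith
  have har₀ : |a| ≤ r₀ := by rw [hr₀]; linarith [le_of_lt h]
  have hΔ₀ : δ ^ 2 ≤ r₀ ^ 2 - 2 * M * r₀ + a ^ 2 := kerrDelta_ge_sq h hδ.le le_rfl
  set m : ℝ := r₀ ^ 2 / (r₀ ^ 2 + a ^ 2) * ((r₀ ^ 2 - 2 * M * r₀ + a ^ 2) / (r₀ ^ 2 + a ^ 2)) with hm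
  have hm0 : 0 < m := by
    rw [hm]
    have : 0 < r₀ ^ 2 - 2 * M * r₀ + a ^ 2 := lt_of_lt_of_le (by positivity) hΔ₀
    positivity
  refine ⟨m, hm0, fun x hx ↦ ?_⟩
  set r : ℝ := Kerr.radius a x with hr
  have hr0 : 0 < r := hr₀0.trans_le hx
  have hΔ : δ ^ 2 ≤ r ^ 2 - 2 * M * r + a ^ 2 := kerrDelta_ge_sq h hδ.le hx
  have hval := kerr_bilin_carterField_le M a hr0 ((sq_nonneg δ).trans hΔ)
  rw [← hr] at hval
  -- monotonicity of the two factors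
  have hf : r₀ ^ 2 / (r₀ ^ 2 + a ^ 2) ≤ r ^ 2 / (r ^ 2 + a ^ 2) := by
    rw [div_le_div_iff₀ (by positivity) (by positivity)]
    have : r₀ ^ 2 ≤ r ^ 2 := pow_le_pow_left₀ hr₀0.le hx 2
    nlinarith [sq_nonneg a]
  have hg : (r₀ ^ 2 - 2 * M * r₀ + a ^ 2) / (r₀ ^ 2 + a ^ 2) ≤ (r ^ 2 - 2 * M * r + a ^ 2) / (r ^ 2 + a ^ 2) :=
    kerrDelta_div_mono hM.le hr₀0 har₀ hx
  have hf0 : 0 ≤ r₀ ^ 2 / (r₀ ^ 2 + a ^ 2) := by positivity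
  have hg0 : 0 ≤ (r₀ ^ 2 - 2 * M * r₀ + a ^ 2) / (r₀ ^ 2 + a ^ 2) :=
    div_nonneg ((sq_nonneg δ).trans hΔ₀) (by positivity)
  have hprod : m ≤ r ^ 2 / (r ^ 2 + a ^ 2) * ((r ^ 2 - 2 * M * r + a ^ 2) / (r ^ 2 + a ^ 2)) := by
    rw [hm]; exact mul_le_mul hf hg hg0 (hf0.trans hf)
  have heq : r ^ 2 / (r ^ 2 + a ^ 2) * ((r ^ 2 - 2 * M * r + a ^ 2) / (r ^ 2 + a ^ 2)) =
      r ^ 2 * (r ^ 2 - 2 * M * r + a ^ 2) / (r ^ 2 + a ^ 2) ^ 2 := by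
    field_simp
  linarith

/-! ### The boosted Carter flow of a moving hole -/

section Boosted

variable (Λ : lorentzGroup) (c : E4) (M a : ℝ)

/-- **The boosted Carter flow is a flow on the boosted Kerr background.** With
`F y σ = c + Λ(carterFlow a (Λ⁻¹(y − c)) σ)` and `u y = Λ χ(Λ⁻¹(y − c))`: smooth in `σ`, `F y 0 = y`,
tangent to `u`, preserving the boosted exterior and the model radius, raising `t*` at unit rate,
with model value the rest Carter value and `‖u y‖ ≤ ‖Λ‖ ‖χ‖`. [cite: Carter1968] -/
theorem boostedCarterFlow_package :
    (∀ y : E4, ContDiff ℝ ∞ (fun σ : ℝ ↦ c + (Λ : E4 ≃L[ℝ] E4) (carterFlow a (poincareInv Λ c y) σ))) ∧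
    (∀ (y : E4) (σ : ℝ), HasDerivAt (fun σ : ℝ ↦ c + (Λ : E4 ≃L[ℝ] E4) (carterFlow a (poincareInv Λ c y) σ))
      ((Λ : E4 ≃L[ℝ] E4) (carterField a (poincareInv Λ c
        (c + (Λ : E4 ≃L[ℝ] E4) (carterFlow a (poincareInv Λ c y) σ))))) σ) ∧
    (∀ y : E4, c + (Λ : E4 ≃L[ℝ] E4) (carterFlow a (poincareInv Λ c y) 0) = y) ∧
    (∀ y : E4, y ∈ (boostedKerrBackground Λ c M a).domain → ∀ σ : ℝ,
      c + (Λ : E4 ≃L[ℝ] E4) (carterFlow a (poincareInv Λ c y) σ) ∈ (boostedKerrBackground Λ c M a).domain) ∧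
    (∀ (y : E4) (σ : ℝ), (boostedKerrBackground Λ c M a).time
      (c + (Λ : E4 ≃L[ℝ] E4) (carterFlow a (poincareInv Λ c y) σ)) =
        (boostedKerrBackground Λ c M a).time y + σ) ∧
    (∀ (y : E4) (σ : ℝ), (boostedKerrBackground Λ c M a).radius
      (c + (Λ : E4 ≃L[ℝ] E4) (carterFlow a (poincareInv Λ c y) σ)) =
        (boostedKerrBackground Λ c M a).radius y) ∧
    (∀ y : E4, (boostedKerrBackground Λ c M a).bilin y
      ((Λ : E4 ≃L[ℝ] E4) (carterField a (poincareInv Λ c y)))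
      ((Λ : E4 ≃L[ℝ] E4) (carterField a (poincareInv Λ c y))) =
        Kerr.bilin M a (poincareInv Λ c y) (carterField a (poincareInv Λ c y))
          (carterField a (poincareInv Λ c y))) ∧
    (∀ y : E4, ‖(Λ : E4 ≃L[ℝ] E4) (carterField a (poincareInv Λ c y))‖ ≤
      ‖((Λ : E4 ≃L[ℝ] E4) : E4 →L[ℝ] E4)‖ * ‖carterField a (poincareInv Λ c y)‖) := by
  have hrest : ∀ (y : E4) (σ : ℝ), poincareInv Λ c (c + (Λ : E4 ≃L[ℝ] E4) (carterFlow a (poincareInv Λ c y) σ)) =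
      carterFlow a (poincareInv Λ c y) σ := fun y σ ↦ poincareInv_centre_add Λ c _
  refine ⟨fun y ↦ ?_, fun y σ ↦ ?_, fun y ↦ ?_, fun y hy σ ↦ ?_, fun y σ ↦ ?_, fun y σ ↦ ?_,
    fun y ↦ ?_, fun y ↦ ?_⟩
  · exact contDiff_const.add (((Λ : E4 ≃L[ℝ] E4) : E4 →L[ℝ] E4).contDiff.comp (contDiff_carterFlow a _))
  · rw [hrest]
    exact ((((Λ : E4 ≃L[ℝ] E4) : E4 →L[ℝ] E4).hasFDerivAt).comp_hasDerivAt σ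
      (hasDerivAt_carterFlow a (poincareInv Λ c y) σ)).const_add c
  · rw [carterFlow_zero, poincareInv, ContinuousLinearEquiv.apply_symm_apply, add_sub_cancel]
  · show poincareInv Λ c _ ∈ (Kerr.exterior M a : Set E4)
    rw [hrest]
    have hy' : poincareInv Λ c y ∈ (Kerr.exterior M a : Set E4) := hy
    rw [SetLike.mem_coe, Kerr.mem_exterior] at hy' ⊢
    rwa [radius_carterFlow]
  · show poincareInv Λ c _ 0 = poincareInv Λ c y 0 + σ
    rw [hrest]; exact (carterFlow_apply a _ σ).1
  · show Kerr.radius a (poincareInv Λ c _) = Kerr.radius a (poincareInv Λ c y)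
    rw [hrest, radius_carterFlow]
  · show boostedKerrBilin Λ c M a y _ _ = _
    rw [boostedKerrBilin_apply, ContinuousLinearEquiv.symm_apply_apply]
  · exact ((Λ : E4 ≃L[ℝ] E4) : E4 →L[ℝ] E4).le_opNorm _

/-- **Uniform model margin and size of the boosted Carter field** on `{r ≥ r₊ + δ}` of the boosted
background (subextremal parameters): `Kb(y)(u y, u y) ≤ −m` and `c₀‖u y‖² < m` for the explicit
`c₀ = m/(4‖Λ‖² + 1)`. [cite: Carter1968] -/
theorem exists_boostedCarter_margin {M a δ : ℝ} (h : Kerr.IsSubextremal M a) (hδ : 0 < δ) :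
    ∃ m > 0, ∃ c₀ > 0, ∀ y : E4, y ∈ (boostedKerrBackground Λ c M a).domain →
      Kerr.rPlus M a + δ ≤ (boostedKerrBackground Λ c M a).radius y →
      (boostedKerrBackground Λ c M a).bilin y ((Λ : E4 ≃L[ℝ] E4) (carterField a (poincareInv Λ c y)))
          ((Λ : E4 ≃L[ℝ] E4) (carterField a (poincareInv Λ c y))) ≤ -m ∧
        c₀ * ‖(Λ : E4 ≃L[ℝ] E4) (carterField a (poincareInv Λ c y))‖ ^ 2 < m := by
  obtain ⟨m, hm, hmarg⟩ := exists_carter_margin h hδ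
  obtain ⟨-, -, -, -, -, -, hbil, hnorm⟩ := boostedCarterFlow_package Λ c M a
  set Γ : ℝ := ‖((Λ : E4 ≃L[ℝ] E4) : E4 →L[ℝ] E4)‖ with hΓ
  refine ⟨m, hm, m / (4 * Γ ^ 2 + 1), by positivity, fun y hy hyr ↦ ⟨?_, ?_⟩⟩
  · rw [hbil]; exact hmarg _ hyr
  · have hr0 : 0 < Kerr.radius a (poincareInv Λ c y) := by
      have hy' : poincareInv Λ c y ∈ (Kerr.exterior M a : Set E4) := hy
      rw [SetLike.mem_coe, Kerr.mem_exterior] at hy'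
      exact (le_max_right _ _).trans_lt hy'
    have h2 := norm_carterField_sq_le a hr0
    have h3 : ‖(Λ : E4 ≃L[ℝ] E4) (carterField a (poincareInv Λ c y))‖ ^ 2 ≤ Γ ^ 2 * 2 := by
      calc ‖(Λ : E4 ≃L[ℝ] E4) (carterField a (poincareInv Λ c y))‖ ^ 2
          ≤ (Γ * ‖carterField a (poincareInv Λ c y)‖) ^ 2 :=
            pow_le_pow_left₀ (norm_nonneg _) (hnorm y) 2
        _ = Γ ^ 2 * ‖carterField a (poincareInv Λ c y)‖ ^ 2 := by ring
        _ ≤ Γ ^ 2 * 2 := mul_le_mul_of_nonneg_left h2 (sq_nonneg _)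
    calc m / (4 * Γ ^ 2 + 1) * ‖(Λ : E4 ≃L[ℝ] E4) (carterField a (poincareInv Λ c y))‖ ^ 2
        ≤ m / (4 * Γ ^ 2 + 1) * (Γ ^ 2 * 2) := mul_le_mul_of_nonneg_left h3 (by positivity)
      _ < m := by
          rw [div_mul_eq_mul_div, div_lt_iff₀ (by positivity)]
          nlinarith [sq_nonneg Γ]

/-- **Certified reach along the boosted Carter flow** (the hypothesis `hstat` of the transfer
`exterior_subset_certified_union_causalPast₂` for a rotating hole): for any chart `ψ` on the boosted
Kerr background and monotone certified radius `R`, if `dψ(u)` is future-directed after model time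
`S₀` on `{r₁ ≤ r ≤ R(t*)}`, then after `S₀` every such model point with `t* ≤ τ₁` lies in the causal
past of `ψ({t* = τ₁, r ≤ R(τ₁)})`. [cite: Carter1968] -/
theorem carter_reach_of_certified {𝓢 : Spacetime 4}
    (ψ : (boostedKerrBackground Λ c M a).domain → 𝓢.carrier) (hψ : ContMDiff 𝓘(ℝ, E4) (𝓡 4) ∞ ψ)
    (R : ℝ → ℝ) (hRm : Monotone R) {r₁ S₀ : ℝ}
    (hKO : ∀ z : (boostedKerrBackground Λ c M a).domain, S₀ ≤ (boostedKerrBackground Λ c M a).time z.1 →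
      r₁ ≤ (boostedKerrBackground Λ c M a).radius z.1 →
      (boostedKerrBackground Λ c M a).radius z.1 ≤ R ((boostedKerrBackground Λ c M a).time z.1) →
        𝓢.timeOrientation.IsFutureDirected (mfderiv 𝓘(ℝ, E4) (𝓡 4) ψ z
          ((Λ : E4 ≃L[ℝ] E4) (carterField a (poincareInv Λ c z.1))))) :
    ∀ (y : (boostedKerrBackground Λ c M a).domain) (τ₁ : ℝ),
      S₀ ≤ (boostedKerrBackground Λ c M a).time y.1 → (boostedKerrBackground Λ c M a).time y.1 ≤ τ₁ →
      r₁ ≤ (boostedKerrBackground Λ c M a).radius y.1 →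
      (boostedKerrBackground Λ c M a).radius y.1 ≤ R ((boostedKerrBackground Λ c M a).time y.1) →
        ψ y ∈ 𝓢.metric.causalPast 𝓢.timeOrientation
          (ψ '' (boostedKerrBackground Λ c M a).truncTimeSlab (R τ₁) τ₁) := by
  obtain ⟨hF, hFu, hF0, hdom, htime, hrad, -, -⟩ := boostedCarterFlow_package Λ c M a
  exact flow_reach_of_certified (boostedKerrBackground Λ c M a)
    (fun y σ ↦ c + (Λ : E4 ≃L[ℝ] E4) (carterFlow a (poincareInv Λ c y) σ))
    (fun y ↦ (Λ : E4 ≃L[ℝ] E4) (carterField a (poincareInv Λ c y))) hF hFu hF0 hdom htime hrad ψ hψ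
    R hRm hKO

end Boosted

/-- Registered one-line form (stub `kerrDelta_ge_sq_rechart` of the crux item) of `kerrDelta_ge_sq`.
[folklore] -/
theorem kerrDelta_ge_sq_rechart : open Literature.Geometry.Lorentzian in ∀ {M a δ r : ℝ}, Kerr.IsSubextremal M a → 0 ≤ δ → Kerr.rPlus M a + δ ≤ r → δ ^ 2 ≤ r ^ 2 - 2 * M * r + a ^ 2 :=
  fun h hδ hr ↦ kerrDelta_ge_sq h hδ hr

end Summit.FinalStateConjecture.FinalStateConjecture.Theorems
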